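import Literature.Analysis.ValidatedNumerics.ParametricLyapunovRexprCertificate
import Literature.Analysis.ValidatedNumerics.ParametricLyapunovTaylorCertificate
import HarnessLib

/-!
# Order-`d` Taylor–Lyapunov leaves for matrix families with `RExpr` entries

Topic `Literature/Analysis/ValidatedNumerics`. The glue of `ParametricLyapunovRexprCertificate.lean`
(per-leaf FIRST-ORDER MODELS `A₀ + Σ_k x_k A^{(k)}` with certified remainder radii `R` of an `RExpr`
matrix family, `rexprAffOK` / `rexprAffOK_sound`) with the INTERVAL-`J` TAYLOR–LYAPUNOV leaf check
`lyapTayLeafOKI` (`ParametricLyapunovTaylorCertificate.lean`, APPEND #7) instead of the affine-`P` leaf: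
on lightly damped families the order-`d` models `P(δ) = Σ_{|α|≤d} δ^α P_α` need far fewer leaves
(the 0.4.0 measurement: Kundur box (vii) 17 affine leaves → 6 at `d = 6`).

* `LyapRexTayLeaf`, `lyapRexTayLeafOK n K E d s r` — a kd-leaf = model `(A₀, A^{(k)}, R)` + enclosure
  precision + a Taylor leaf `LyapTayLeaf`, checked by `rexprAffOK` and by `lyapTayLeafOKI` on the balanced,
  shifted LOCAL family `(D A₀ D⁻¹ + s·1, D A^{(k)} D⁻¹)` with radii `D R D⁻¹`;
* `re_le_neg_of_lyapRexTayLeafOK`, **`re_le_neg_of_kdCheck_lyapRexTay`** (END-TO-END: positive scaling and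
  an accepted kd-tree ⇒ ∀ `x` ∈ box, ∀ `μ ∈ σ(E(x))`, `Re μ ≤ −(s + r)`), `re_neg_of_kdCheck_lyapRexTay`.

Per leaf the proof is literally `re_le_neg_of_kdCheck_lyapTayI_conj_shifted` on the one-leaf tree with
the member `J′ := E(x)` supplied by `rexprAffOK_sound`. Nothing here is new mathematics.
[GahinetApkarianChilali1996] §III, [Hladik2017] §3, [CarlsonSchneider1962] §1, [Moore1979] §4.4 eq. (4.19) — through
the imports. Everything here is proved; no named facts.
-/

noncomputable section

open Finset Matrix NonemptyInterval Set

namespace Literature.Analysis.ValidatedNumerics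

/-- A kd-leaf for an `RExpr` family with an order-`d` Taylor–Lyapunov certificate: the ABSOLUTE affine
model `(A₀, A^{(k)})` of the entries on the leaf box, the remainder radii `R`, the enclosure precision
`(prec, Heron steps)`, and a `LyapTayLeaf` for the balanced, shifted local family.
[cite: GahinetApkarianChilali1996, §III; Moore1979, §4.4 eq. (4.19) (p. 43)] -/
structure LyapRexTayLeaf where
  /-- constant table of the affine model (absolute coordinates) -/
  A0 : List (List ℚ)
  /-- slope tables `A^{(k)}`, `k < K` -/
  As : List (List (List ℚ))
  /-- entrywise remainder radii `R ≥ |E(x) − (A₀ + Σ x_k A^{(k)})|` on the leaf -/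
  R : List (List ℚ)
  /-- enclosure precision and Heron steps for the kernel's interval evaluations -/
  pq : ℕ × ℕ
  /-- the Taylor–Lyapunov leaf data (`α_i, P_i, β_j, π`, three `LDLCert`s) -/
  inner : LyapTayLeaf
  deriving Inhabited

/-- **The leaf check**: the model encloses the table on the leaf box AND the interval-`J` Taylor leaf
check `lyapTayLeafOKI` accepts the balanced (`d`), shifted (`s`) local model with the balanced radii and
rate `r`. [cite: GahinetApkarianChilali1996, §III; Hladik2017, §3; Moore1979, §4.4 eq. (4.19) (p. 43)] -/
def lyapRexTayLeafOK (n K : ℕ) (E : List (List RExpr)) (d : List ℚ) (s r : ℚ) (B : Box)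
    (l : LyapRexTayLeaf) : Bool :=
  rexprAffOK n K E B l.A0 l.As l.R l.pq &&
    lyapTayLeafOKI n K (addDiagTab n s (conjDiagTab n d l.A0))
      (vtab K fun k ↦ conjDiagTab n d (l.As.getD k [])) (conjDiagTab n d l.R) r B l.inner

/-- **Per leaf**: positive scaling and an accepted leaf ⇒ every complex eigenvalue `μ` of `E(x)`, `x` in
the leaf box, has `Re μ ≤ −(s + r)`.
[cite: GahinetApkarianChilali1996, §III; CarlsonSchneider1962, § 1; Moore1979, §4.4 eq. (4.19) (p. 43)] -/
theorem re_le_neg_of_lyapRexTayLeafOK {n K : ℕ} {E : List (List RExpr)} {d : List ℚ} {s r : ℚ}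
    {B : Box} {l : LyapRexTayLeaf} (hd : posListQ n d = true)
    (h : lyapRexTayLeafOK n K E d s r B l = true) (x : ℕ → ℝ) (hx : B.mem x) {μ : ℂ}
    (hμ : μ ∈ spectrum ℂ ((rexprMatrix n E x).map (algebraMap ℝ ℂ))) :
    μ.re ≤ -((s + r : ℚ) : ℝ) := by
  unfold lyapRexTayLeafOK at h
  rw [Bool.and_eq_true] at h
  exact re_le_neg_of_kdCheck_lyapTayI_conj_shifted (t := KdCert.leaf l.inner) hd h.2 x hx
    (rexprAffOK_sound h.1 x hx) hμ

/-- **`RExpr` Taylor–Lyapunov certificate, box level (END-TO-END).** If the scaling `d` is positive and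
the kd-tree checks with `lyapRexTayLeafOK n K E d s r` on `B`, then for every `x` of `B` every complex
eigenvalue `μ` of `E(x)` satisfies `Re μ ≤ −(s + r)`.
[cite: GahinetApkarianChilali1996, §III; CarlsonSchneider1962, § 1; Moore1979, §4.4 eq. (4.19) (p. 43)] -/
theorem re_le_neg_of_kdCheck_lyapRexTay {n K : ℕ} {E : List (List RExpr)} {d : List ℚ} {s r : ℚ}
    {B : Box} {t : KdCert LyapRexTayLeaf} (hd : posListQ n d = true)
    (h : t.check (lyapRexTayLeafOK n K E d s r) B = true) (x : ℕ → ℝ) (hx : B.mem x) {μ : ℂ}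
    (hμ : μ ∈ spectrum ℂ ((rexprMatrix n E x).map (algebraMap ℝ ℂ))) :
    μ.re ≤ -((s + r : ℚ) : ℝ) :=
  KdCert.sound (P := fun x ↦ ∀ μ : ℂ, μ ∈ spectrum ℂ ((rexprMatrix n E x).map (algebraMap ℝ ℂ)) →
      μ.re ≤ -((s + r : ℚ) : ℝ))
    (fun _ _ hl x hx _ hμ ↦ re_le_neg_of_lyapRexTayLeafOK hd hl x hx hμ) t B h x hx μ hμ

/-- **Hurwitz on the whole box** when `0 < s + r`. [cite: CarlsonSchneider1962, § 1] -/
theorem re_neg_of_kdCheck_lyapRexTay {n K : ℕ} {E : List (List RExpr)} {d : List ℚ} {s r : ℚ}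
    {B : Box} {t : KdCert LyapRexTayLeaf} (hd : posListQ n d = true)
    (h : t.check (lyapRexTayLeafOK n K E d s r) B = true) (hsr : 0 < s + r) (x : ℕ → ℝ) (hx : B.mem x)
    {μ : ℂ} (hμ : μ ∈ spectrum ℂ ((rexprMatrix n E x).map (algebraMap ℝ ℂ))) : μ.re < 0 :=
  (re_le_neg_of_kdCheck_lyapRexTay hd h x hx hμ).trans_lt (by
    have : (0 : ℝ) < ((s + r : ℚ) : ℝ) := by exact_mod_cast hsr
    linarith)

/-! ## APPEND #1 (2026-08-27, session 7): the FAST form of the `RExpr` Taylor leaf check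

`lyapRexTayLeafOKF` = `lyapRexTayLeafOK` with the fast interval Taylor checker `lyapTayLeafOKFI`
(`ParametricLyapunovTaylorCertificate.lean`, APPEND #8) in place of `lyapTayLeafOKI`; same tables, so
`lyapRexTayLeafOKF ⇒ lyapRexTayLeafOK` and the END-TO-END theorem transfers.
[cite: GahinetApkarianChilali1996, §III; Hladik2017, §3] -/

/-- **The FAST leaf check** for `RExpr` families with Taylor leaves.
[cite: GahinetApkarianChilali1996, §III; Hladik2017, §3; Moore1979, §4.4 eq. (4.19) (p. 43)] -/
def lyapRexTayLeafOKF (n K : ℕ) (E : List (List RExpr)) (d : List ℚ) (s r : ℚ) (B : Box)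
    (l : LyapRexTayLeaf) : Bool :=
  rexprAffOK n K E B l.A0 l.As l.R l.pq &&
    lyapTayLeafOKFI n K (addDiagTab n s (conjDiagTab n d l.A0))
      (vtab K fun k ↦ conjDiagTab n d (l.As.getD k [])) (conjDiagTab n d l.R) r B l.inner

/-- **Fast ⇒ plain** for the `RExpr` Taylor leaf check. [cite: GahinetApkarianChilali1996, §III; Hladik2017, §3] -/
theorem lyapRexTayLeafOK_of_F {n K : ℕ} {E : List (List RExpr)} {d : List ℚ} {s r : ℚ} {B : Box}
    {l : LyapRexTayLeaf} (h : lyapRexTayLeafOKF n K E d s r B l = true) :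
    lyapRexTayLeafOK n K E d s r B l = true := by
  unfold lyapRexTayLeafOKF at h
  unfold lyapRexTayLeafOK
  rw [Bool.and_eq_true] at h ⊢
  exact ⟨h.1, lyapTayLeafOKI_of_FI h.2⟩

/-- **`RExpr` Taylor–Lyapunov certificate through the FAST check, box level (END-TO-END).**
[cite: GahinetApkarianChilali1996, §III; CarlsonSchneider1962, § 1; Moore1979, §4.4 eq. (4.19) (p. 43)] -/
theorem re_le_neg_of_kdCheck_lyapRexTayF {n K : ℕ} {E : List (List RExpr)} {d : List ℚ} {s r : ℚ}
    {B : Box} {t : KdCert LyapRexTayLeaf} (hd : posListQ n d = true)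
    (h : t.check (lyapRexTayLeafOKF n K E d s r) B = true) (x : ℕ → ℝ) (hx : B.mem x) {μ : ℂ}
    (hμ : μ ∈ spectrum ℂ ((rexprMatrix n E x).map (algebraMap ℝ ℂ))) :
    μ.re ≤ -((s + r : ℚ) : ℝ) :=
  KdCert.sound (P := fun x ↦ ∀ μ : ℂ, μ ∈ spectrum ℂ ((rexprMatrix n E x).map (algebraMap ℝ ℂ)) →
      μ.re ≤ -((s + r : ℚ) : ℝ))
    (fun _ _ hl x hx _ hμ ↦ re_le_neg_of_lyapRexTayLeafOK hd (lyapRexTayLeafOK_of_F hl) x hx hμ) t B h x hx μ hμ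

end Literature.Analysis.ValidatedNumerics
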